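import Literature.Barriers.AtomisticToContinuum.AnticontinuumLocalizationGeometrySymbol
import Mathlib.Analysis.Calculus.LocalExtr.Basic
import Mathlib.Analysis.Calculus.Deriv.Mul
import HarnessLib

/-!
# De Roeck–Huveneers 2015, Prop. 2, second item (§4.3): invariance of `θ_x` along resonant directions; the cut-offs assembled

`Literature/Barriers/AtomisticToContinuum/` — continuation of `…GeometrySymbol.lean`: the case
analysis of §4.3 (proof of Proposition 2) of W. De Roeck, F. Huveneers, CPAM 68 (2015), arXiv:1305.5127,
proving **the second item of Proposition 2** in the derivative form used in §5 — for `ω ∉ S(x)`, `k ∈ K_r` with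
`|k·ω| ≤ 2δ`, `∂_t θ_x(ω + tk)|_{t=0} = 0` (`fderiv_thetaW_eq_zero`): per cluster `Q`, either `ψ_Q`
has a local extremum at `ω` (values `0` or `1`), or (case 1 of the source, `k ⊥ span Q`; case 2, `k ∈ span Q`, Lemma 2)
`ψ_Q` is constant along the segment, or (case 3, `|Q| < n₂`, Lemma 3) `ω` lies in the core block of
the cluster `Q ∪ {k}` together with the whole segment, where `θ_x ≡ 0`; `|Q| = n₂` in case 3 is
exactly `ω ∈ S(x)` (`multiResW`). Then the multi-resonance output (`multiResW_subset`, the definition of `S_{δ,n₂}(x)`)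
and the packaged structure **`resonanceCutoffs m r n₂ : ResonanceCutoffs m r (cutoffL m r) n₂`** with
`Rθ = RS = 4r + 2r(n₂ - 1)` (`exists_cutoffs`). All proved; no named facts.
-/

noncomputable section

open Function Set Finset Filter Metric WithLp Module
open scoped BigOperators Topology InnerProductSpace

namespace Literature.Barriers.AtomisticToContinuum.HeatConduction.RotorChain

open Literature.MathematicalPhysics.KineticTheory.HeatConduction Literature.Analysis.Calculus

variable {m : ℕ}

section CaseAnalysis

open scoped Classical

variable {r n₂ : ℕ} {L δ C : ℝ} {x : Fin m} {Q : Finset (Fin m → ℤ)} {k : Fin m → ℤ} {ξ v : Euc m}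

/-- The core block lies in the enlarged block. [folklore] -/
theorem InCore.inEnlarged (hδ : 0 < δ) (h : InCore r L δ Q ξ) : InEnlarged r L δ Q ξ :=
  ⟨lt_of_le_of_lt h.1 (by nlinarith), fun Q' hQ' => lt_of_le_of_lt (h.2 Q' hQ') (by nlinarith)⟩

/-- **Case 2 of the source** (`k ∈ span Q`): along `v ∈ ℝk`, `‖v‖ ≤ δ`, `ψ_Q(ω + v)` equals the product of the
sub-family factors with `k ∈ span Q'` evaluated at `ω` — independent of `v`. [cite: DeRoeckHuveneers2015, §4.3 proof of Prop. 2, case 2 ("by Lemma 2, for `|t| ≤ δ` we still have `ω + ω' + tk ∈ B(k_1, …, k_p)`")] -/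
theorem psiQ_translate_inSpan (hC : IsLemma1Const m r C) (hL : lemmaL C 2 ≤ L) (hδ : 0 < δ)
    (hQli : IsLI Q) (hk : k ∈ BModes m r) (hkV : kvec k ∈ modeSpan Q)
    (hω : InEnlarged r L δ Q ξ) (hres : |⟪kvec k, ξ⟫_ℝ| ≤ 2 * δ) (hv : v ∈ ℝ ∙ kvec k) (hvn : ‖v‖ ≤ δ) :
    psiQ r L Q δ (ξ + v) = ∏ Q' ∈ subFamilies r Q,
      (if kvec k ∈ modeSpan Q' then stepDown (((L ^ Q.card - L ^ Q'.card) * δ) ^ 2) (((L ^ Q.card - L ^ Q'.card + 1) * δ) ^ 2) (eQ Q Q' ξ ^ 2)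
        else 1) := by
  have hL1 : 1 ≤ L := by
    have : 0 ≤ 2 * C ^ 2 * (6 + 2 ^ 2) + C * (2 + 2) := by have := hC.1; positivity
    rw [lemmaL] at hL; linarith
  have hmain0 : 0 ≤ L ^ Q.card := by positivity
  have h1 : dQ Q (ξ + v) ≤ L ^ Q.card * δ := lemma2_main hC (by norm_num) hL hδ hk hkV hω hres hv hvn
  unfold psiQ
  rw [(stepDown_sq_eq_one_iff hmain0 hδ (dQ_nonneg Q _)).2 h1, one_mul]
  refine Finset.prod_congr rfl fun Q' hQ' => ?_
  by_cases hkQ' : kvec k ∈ modeSpan Q'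
  · rw [if_pos hkQ', lemma2_fixed hQ' hkQ' hv ξ]
  · rw [if_neg hkQ']
    exact (stepDown_sq_eq_one_iff (pow_sub_nonneg hL1 hQli hQ') hδ (eQ_nonneg Q Q' _)).2
      (lemma2_sub hC (by norm_num) hL hδ hQli hk hkV hω hres hv hvn hQ' hkQ')

/-- Case 2 of the source, constancy: `ψ_Q(ω + v) = ψ_Q(ω)`. [cite: DeRoeckHuveneers2015, §4.3 proof of Prop. 2, case 2] -/
theorem psiQ_translate_inSpan_eq (hC : IsLemma1Const m r C) (hL : lemmaL C 2 ≤ L) (hδ : 0 < δ)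
    (hQli : IsLI Q) (hk : k ∈ BModes m r) (hkV : kvec k ∈ modeSpan Q)
    (hω : InEnlarged r L δ Q ξ) (hres : |⟪kvec k, ξ⟫_ℝ| ≤ 2 * δ) (hv : v ∈ ℝ ∙ kvec k) (hvn : ‖v‖ ≤ δ) :
    psiQ r L Q δ (ξ + v) = psiQ r L Q δ ξ := by
  rw [psiQ_translate_inSpan hC hL hδ hQli hk hkV hω hres hv hvn]
  conv_rhs => rw [← add_zero ξ]
  rw [psiQ_translate_inSpan hC hL hδ hQli hk hkV hω hres (Submodule.zero_mem _) (by rw [norm_zero]; exact hδ.le)]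

/-- **Case 1 of the source** (`k ⊥ span Q`): `ψ_Q(ω + v) = ψ_Q(ω)` for all `v ∈ ℝk`. [cite: DeRoeckHuveneers2015, §4.3 proof of Prop. 2, case 1 ("It is then seen from the definition of `B(k_1, …, k_p)` that, for every `t ∈ ℝ`, `ω + ω' + tk ∈ B(k_1, …, k_p)`")] -/
theorem psiQ_translate_orth (hkO : kvec k ∈ (modeSpan Q)ᗮ) (hv : v ∈ ℝ ∙ kvec k) (δ : ℝ) :
    psiQ r L Q δ (ξ + v) = psiQ r L Q δ ξ := by
  have hvO : v ∈ (modeSpan Q)ᗮ := (Submodule.span_singleton_le_iff_mem _ _).2 hkO hv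
  have hP : proj Q (ξ + v) = proj Q ξ := by
    have h0 : proj Q v = 0 := (modeSpan Q).starProjection_apply_eq_zero_iff.2 hvO
    rw [map_add, h0, add_zero]
  have hP' : ∀ Q' ∈ subFamilies r Q, proj Q' (ξ + v) = proj Q' ξ := by
    intro Q' hQ'
    have hle := (mem_subFamilies.1 hQ').2.2.2
    have h0 : proj Q' v = 0 := (modeSpan Q').starProjection_apply_eq_zero_iff.2 (Submodule.orthogonal_le hle hvO)
    rw [map_add, h0, add_zero]
  unfold psiQ dQ eQ
  rw [hP]
  congr 1
  exact Finset.prod_congr rfl fun Q' hQ' => by rw [hP' Q' hQ']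

/-- **Case 3** (`|Q| < n₂`, `k ∉ span Q`, `k` not orthogonal to `span Q`): `ω` and the whole segment
`ω + v`, `v ∈ ℝk`, `‖v‖ ≤ δ`, lie in the core block of the cluster `Q ∪ {k}`, where `θ_x = 0`.
[cite: DeRoeckHuveneers2015, §4.3 proof of Prop. 2, case 3, and Lemma 3] -/
theorem thetaX_translate_case3 (hC : IsLemma1Const m r C) (hL : lemmaL C 2 ≤ L) (hδ : 0 < δ)
    (hQ : Q ∈ clusters r n₂ x) (hcard : Q.card < n₂) (hk : IsKMode r k) (hkV : kvec k ∉ modeSpan Q) (hkO : kvec k ∉ (modeSpan Q)ᗮ)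
    (hω : InEnlarged r L δ Q ξ) (hres : |⟪kvec k, ξ⟫_ℝ| ≤ 2 * δ) (hv : v ∈ ℝ ∙ kvec k) (hvn : ‖v‖ ≤ δ) :
    thetaX r L n₂ x δ (ξ + v) = 0 := by
  obtain ⟨hcl, -⟩ := mem_clusters.1 hQ
  have hL1 : 1 ≤ L := by
    have : 0 ≤ 2 * C ^ 2 * (6 + 2 ^ 2) + C * (2 + 2) := by have := hC.1; positivity
    rw [lemmaL] at hL; linarith
  have hkB : k ∈ BModes m r := mem_BModes_of_isKMode hk
  have hkQ : k ∉ Q := fun h => hkV (kvec_mem_modeSpan h)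
  -- the extended cluster
  have hcl' : IsClusterAround r x (insert k Q) := isClusterAround_insert hcl hk hkV hkO
  have hcard' : (insert k Q).card ≤ n₂ := by rw [Finset.card_insert_of_notMem hkQ]; exact hcard
  have hQ' : insert k Q ∈ clusters r n₂ x := mem_clusters.2 ⟨hcl', hcard'⟩
  have hli' : IsLI (insert k Q) := hcl'.2.2.1
  -- Lemma 3: `ξ` is in the core block of `Q ∪ {k}`; Lemma 2 keeps the segment there
  obtain ⟨-, hcore⟩ := lemma3 hC (by norm_num) hL hδ hcl.subset_BModes hcl.2.2.1 hkB hkV hω hres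
  have henl' : InEnlarged r L δ (insert k Q) ξ := hcore.inEnlarged hδ
  have hkV' : kvec k ∈ modeSpan (insert k Q) := kvec_mem_modeSpan (Finset.mem_insert_self k Q)
  have hcore_v : InCore r L δ (insert k Q) (ξ + v) := by
    refine ⟨lemma2_main hC (by norm_num) hL hδ hkB hkV' henl' hres hv hvn, fun Q' hQ'' => ?_⟩
    by_cases hkQ' : kvec k ∈ modeSpan Q'
    · rw [lemma2_fixed hQ'' hkQ' hv ξ]; exact hcore.2 Q' hQ''
    · exact lemma2_sub hC (by norm_num) hL hδ hli' hkB hkV' henl' hres hv hvn hQ'' hkQ'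
  have hpsi : psiQ r L (insert k Q) δ (ξ + v) = 1 := (psiQ_eq_one_iff hL1 hδ hli' _).2 hcore_v
  unfold thetaX
  exact Finset.prod_eq_zero hQ' (by rw [hpsi, sub_self])

end CaseAnalysis

/-! ### The second item of Proposition 2: the derivative of `θ_x` along resonant directions vanishes off `S(x)` -/

section Derivative

open scoped Classical

variable {r n₂ : ℕ} {L δ C : ℝ} {x : Fin m}

/-- **The multi-resonance set `S(x)`** (window version): `ω` lies in the enlarged block of a cluster
of full size `n₂` around `x`. [cite: DeRoeckHuveneers2015, §4.2 (definition of `S_{δ,n₂}(x)`) and §4.3 (proof of Prop. 2, case 3: "So `p = n₂` should hold")] -/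
def multiResW (r : ℕ) (L : ℝ) (n₂ : ℕ) (x : Fin m) (δ : ℝ) : Set (Fin m → ℝ) :=
  {w | ∃ Q ∈ clusters r n₂ x, Q.card = n₂ ∧ InEnlarged r L δ Q (wvec w)}

/-- `wvec` along a line. [folklore] -/
theorem wvec_add_smul_modeVec (w : Fin m → ℝ) (t : ℝ) (k : Fin m → ℤ) : wvec (w + t • modeVec k) = wvec w + t • kvec k := by
  rfl

/-- `lemmaL C 2 ≥ 1`. [folklore] -/
theorem one_le_of_lemmaL (hC : IsLemma1Const m r C) (hL : lemmaL C 2 ≤ L) : 1 ≤ L := by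
  have : 0 ≤ 2 * C ^ 2 * (6 + 2 ^ 2) + C * (2 + 2) := by have := hC.1; positivity
  rw [lemmaL] at hL; linarith

/-- **The second item of Proposition 2, derivative form**: for `ω ∉ S(x)`, `k ∈ K_r` with `|k·ω| ≤ 2δ`,
`∂_t θ_x(ω + tk)|_{t=0} = 0`. [cite: DeRoeckHuveneers2015, §4.2 Prop. 2, second item, and its proof in §4.3 ("It is thus enough to show that `k·∇_ω θ_x(ω) = 0` for every `k ∈ K_r` and every `ω ∉ S_{n₂}(x)` such that `|k·ω| ≤ 2δ`"; cases 1–3)] -/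
theorem fderiv_thetaW_eq_zero (hC : IsLemma1Const m r C) (hL : lemmaL C 2 ≤ L) (hδ : 0 < δ) (hδ1 : δ ≤ 1)
    {w : Fin m → ℝ} (hw : w ∉ multiResW r L n₂ x δ) {k : Fin m → ℤ} (hk : IsKMode r k) (hres : |modeFreq k w| ≤ 2 * δ) :
    fderiv ℝ (thetaW r L n₂ x δ) w (modeVec k) = 0 := by
  have hL1 : 1 ≤ L := one_le_of_lemmaL hC hL
  -- the line through `w` in direction `k`
  set γ : ℝ → (Fin m → ℝ) := fun t => w + t • modeVec k with hγdef
  have hγ : HasDerivAt γ (modeVec k) 0 := by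
    have := ((hasDerivAt_id (0 : ℝ)).smul_const (modeVec k)).const_add w
    rw [one_smul] at this
    exact this
  have hγ0 : γ 0 = w := by simp [hγdef]
  have hθd : Differentiable ℝ (thetaW r L n₂ x δ) := ((isDeltaSymbol_thetaW hL1).contDiff hδ hδ1).differentiable (by simp)
  have hcomp : HasDerivAt (thetaW r L n₂ x δ ∘ γ) (fderiv ℝ (thetaW r L n₂ x δ) w (modeVec k)) 0 := by
    have h1 : HasFDerivAt (thetaW r L n₂ x δ) (fderiv ℝ (thetaW r L n₂ x δ) (γ 0)) (γ 0) := (hθd _).hasFDerivAt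
    have := h1.comp_hasDerivAt (0 : ℝ) hγ
    rwa [hγ0] at this
  suffices h0 : HasDerivAt (thetaW r L n₂ x δ ∘ γ) 0 0 from hcomp.unique h0
  -- hypotheses in Euclidean form
  have hres' : |⟪kvec k, wvec w⟫_ℝ| ≤ 2 * δ := by rwa [inner_kvec_wvec]
  have hkB : k ∈ BModes m r := mem_BModes_of_isKMode hk
  have hk0 : kvec k ≠ 0 := kvec_ne_zero hk.1
  have hkn : 0 < ‖kvec k‖ := norm_pos_iff.2 hk0
  set t₀ : ℝ := δ / ‖kvec k‖ with ht₀def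
  have ht₀ : 0 < t₀ := div_pos hδ hkn
  have hsmall : ∀ t : ℝ, |t| < t₀ → t • kvec k ∈ ℝ ∙ kvec k ∧ ‖t • kvec k‖ ≤ δ := fun t ht =>
    ⟨Submodule.smul_mem _ _ (Submodule.mem_span_singleton_self _), by
      rw [norm_smul, Real.norm_eq_abs]
      rw [ht₀def, lt_div_iff₀ hkn] at ht
      exact ht.le⟩
  have hnhds : Set.Ioo (-t₀) t₀ ∈ 𝓝 (0 : ℝ) := Ioo_mem_nhds (by linarith) ht₀
  by_cases h3 : ∃ Q ∈ clusters r n₂ x, Q.card < n₂ ∧ kvec k ∉ modeSpan Q ∧ kvec k ∉ (modeSpan Q)ᗮ ∧ InEnlarged r L δ Q (wvec w)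
  · -- case 3 with room: `θ_x` vanishes along the segment
    obtain ⟨Q, hQ, hcard, hkV, hkO, hω⟩ := h3
    have hev : (thetaW r L n₂ x δ ∘ γ) =ᶠ[𝓝 0] fun _ => (0 : ℝ) := by
      filter_upwards [hnhds] with t ht
      have ht' : |t| < t₀ := abs_lt.2 ht
      show thetaX r L n₂ x δ (wvec (w + t • modeVec k)) = 0
      rw [wvec_add_smul_modeVec]
      exact thetaX_translate_case3 hC hL hδ hQ hcard hk hkV hkO hω hres' (hsmall t ht').1 (hsmall t ht').2
    exact (hasDerivAt_const (0 : ℝ) (0 : ℝ)).congr_of_eventuallyEq hev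
  · -- otherwise every factor has zero derivative along the line
    push Not at h3
    have hfac : ∀ Q ∈ clusters r n₂ x, HasDerivAt (fun t => 1 - psiQ r L Q δ (wvec (γ t))) 0 0 := by
      intro Q hQ
      obtain ⟨hcl, hcardle⟩ := mem_clusters.1 hQ
      have hli : IsLI Q := hcl.2.2.1
      set f : ℝ → ℝ := fun t => psiQ r L Q δ (wvec (γ t)) with hfdef
      have hψd : Differentiable ℝ (fun w' : Fin m → ℝ => psiQ r L Q δ (wvec w')) :=
        ((isDeltaSymbol_psiQ (r := r) hL1 hli).contDiff hδ hδ1).differentiable (by simp)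
      have hfd : DifferentiableAt ℝ f 0 := by
        have := ((hψd (γ 0)).hasFDerivAt.comp_hasDerivAt (0 : ℝ) hγ).differentiableAt
        exact this
      have hf0 : f 0 = psiQ r L Q δ (wvec w) := by simp [hfdef, hγ0]
      suffices hf : HasDerivAt f 0 0 by
        have := hf.const_sub (1 : ℝ)
        rwa [neg_zero] at this
      have hψ0 := psiQ_nonneg (r := r) (L := L) Q δ (wvec w)
      have hψ1 := psiQ_le_one (r := r) (L := L) Q δ (wvec w)
      rcases hψ0.eq_or_lt with h0 | hpos
      · -- `ψ_Q(ω) = 0`: a local minimum along the line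
        have hmin : IsLocalMin f 0 := Filter.Eventually.of_forall fun t => by
          rw [hf0, ← h0]; exact psiQ_nonneg _ _ _
        have := hmin.hasDerivAt_eq_zero hfd.hasDerivAt
        have h := hfd.hasDerivAt
        rwa [this] at h
      rcases hψ1.lt_or_eq with hlt1 | h1
      · -- `0 < ψ_Q(ω) < 1`: the enlarged block; `ψ_Q` is constant along the segment (cases 1, 2)
        have hω : InEnlarged r L δ Q (wvec w) := (psiQ_pos_iff hL1 hδ hli _).1 hpos
        have hconst : ∀ t, |t| < t₀ → f t = f 0 := by
          intro t ht
          rw [hf0]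
          show psiQ r L Q δ (wvec (w + t • modeVec k)) = _
          rw [wvec_add_smul_modeVec]
          by_cases hkV : kvec k ∈ modeSpan Q
          · exact psiQ_translate_inSpan_eq hC hL hδ hli hkB hkV hω hres' (hsmall t ht).1 (hsmall t ht).2
          · by_cases hkO : kvec k ∈ (modeSpan Q)ᗮ
            · exact psiQ_translate_orth hkO (hsmall t ht).1 δ
            · exfalso
              rcases Nat.lt_or_ge Q.card n₂ with hlt | hge
              · exact h3 Q hQ hlt hkV hkO hω
              · exact hw ⟨Q, hQ, le_antisymm hcardle hge, hω⟩
        have hev : f =ᶠ[𝓝 0] fun _ => f 0 := by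
          filter_upwards [hnhds] with t ht
          exact hconst t (abs_lt.2 ht)
        exact (hasDerivAt_const (0 : ℝ) (f 0)).congr_of_eventuallyEq hev
      · -- `ψ_Q(ω) = 1`: a local maximum along the line
        have hmax : IsLocalMax f 0 := Filter.Eventually.of_forall fun t => by
          rw [hf0, h1]; exact psiQ_le_one _ _ _
        have := hmax.hasDerivAt_eq_zero hfd.hasDerivAt
        have h := hfd.hasDerivAt
        rwa [this] at h
    have hprod := HasDerivAt.fun_finsetProd (u := clusters r n₂ x) hfac
    simp only [smul_zero, Finset.sum_const_zero] at hprod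
    exact hprod

/-- Frequencies of members of a cluster in its enlarged block are `≤ L^{n₂+1}δ` (`L ≥ 2rm`). [cite: DeRoeckHuveneers2015, §4.3 proof of Prop. 2, case 3 ("`|k_j·ω| ≤ |k_j|₂ L^{n₂}δ + 4r²δ ≤ L^{n₂+1}δ`")] -/
theorem freq_le_of_inEnlarged (hL : 1 ≤ L) (hLr : 2 * (r : ℝ) * m ≤ L) (hδ : 0 < δ) {Q : Finset (Fin m → ℤ)}
    (hQ : IsClusterAround r x Q) (hcard : Q.card ≤ n₂) {w : Fin m → ℝ} (henl : InEnlarged r L δ Q (wvec w))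
    {k : Fin m → ℤ} (hk : k ∈ Q) : |modeFreq k w| ≤ L ^ (n₂ + 1) * δ := by
  have h1 := abs_inner_kvec_le_of_mem hk (wvec w)
  rw [inner_kvec_wvec] at h1
  have h2 : dQ Q (wvec w) < (L ^ Q.card + 1) * δ := henl.1
  have hkn : ‖kvec k‖ ≤ r * m := norm_kvec_le (hQ.2.1 k hk).2.1
  have hpow : L ^ Q.card ≤ L ^ n₂ := pow_le_pow_right₀ hL hcard
  have hpow1 : 1 ≤ L ^ n₂ := one_le_pow₀ hL
  have hdn : 0 ≤ dQ Q (wvec w) := dQ_nonneg _ _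
  calc |modeFreq k w| ≤ ‖kvec k‖ * ‖proj Q (wvec w)‖ := h1
    _ = ‖kvec k‖ * dQ Q (wvec w) := rfl
    _ ≤ (r * m) * ((L ^ n₂ + 1) * δ) := mul_le_mul hkn (by nlinarith) hdn (by positivity)
    _ ≤ (r * m) * (2 * L ^ n₂ * δ) := by gcongr; linarith
    _ = (2 * r * m) * L ^ n₂ * δ := by ring
    _ ≤ L * L ^ n₂ * δ := by gcongr
    _ = L ^ (n₂ + 1) * δ := by rw [pow_succ]; ring

/-- **On `S(x)` there are `n₂` linearly independent `k_j ∈ K_r(B(x, 4r + 2r(n₂-1)))` with `|k_j·ω| ≤ L^{n₂+1}δ`**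
(the definition of `S_{δ,n₂}(x)`: "there exists a cluster `{k_1, …, k_{n₂}}` around `x`, such that
`|k_j·ω| ≤ L^{n₂+1}δ` for every `1 ≤ j ≤ n₂`"). [cite: DeRoeckHuveneers2015, §4.2 (definition of `S_{δ,n₂}(x)`)] -/
theorem multiResW_subset (hL : 1 ≤ L) (hLr : 2 * (r : ℝ) * m ≤ L) (hδ : 0 < δ) {w : Fin m → ℝ} (hw : w ∈ multiResW r L n₂ x δ) :
    ∃ ks : Fin n₂ → (Fin m → ℤ), LinearIndependent ℝ (fun j => modeVec (ks j)) ∧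
      ∀ j, IsKMode r (ks j) ∧ ModeNear x (clusterRad r n₂) (ks j) ∧ |modeFreq (ks j) w| ≤ L ^ (n₂ + 1) * δ := by
  obtain ⟨Q, hQ, hcard, henl⟩ := hw
  obtain ⟨hcl, hcardle⟩ := mem_clusters.1 hQ
  -- enumerate `Q`
  let e : Fin n₂ ≃ {q // q ∈ Q} := (finCongr hcard.symm).trans Q.equivFin.symm
  refine ⟨fun j => (e j : Fin m → ℤ), ?_, fun j => ⟨hcl.2.1 _ (e j).2, ?_, freq_le_of_inEnlarged hL hLr hδ hcl hcardle henl (e j).2⟩⟩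
  · -- linear independence transported from `IsLI Q`
    have hli : LinearIndependent ℝ (fun q : {q // q ∈ Q} => kvec (q : Fin m → ℤ)) := hcl.2.2.1
    have h1 : LinearIndependent ℝ (fun j => kvec (m := m) (e j)) := hli.comp e e.injective
    have h2 : (fun j => kvec (m := m) (e j)) = ((EuclideanSpace.equiv (Fin m) ℝ).symm.toLinearEquiv.toLinearMap) ∘ (fun j => modeVec (e j : Fin m → ℤ)) := by
      funext j; rfl
    rw [h2] at h1
    exact LinearIndependent.of_comp _ h1
  · intro y hy
    exact hcl.2.2.2 _ (e j).2 y (by rw [hcard]; exact hy)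

end Derivative

/-! ### The cut-offs assembled -/

/-- A Lemma-1 constant, chosen. [cite: DeRoeckHuveneers2015, §4.3 Lemma 1] -/
def lemma1Const (m r : ℕ) : ℝ := Classical.choose (exists_isLemma1Const m r)

/-- Its defining property. [cite: DeRoeckHuveneers2015, §4.3 Lemma 1] -/
theorem isLemma1Const_lemma1Const (m r : ℕ) : IsLemma1Const m r (lemma1Const m r) := Classical.choose_spec (exists_isLemma1Const m r)

/-- **The constant `L`** of §4: an integer above `lemmaL C 2` and `2rm + 3`. [cite: DeRoeckHuveneers2015, §4.2 Prop. 2 ("The following holds for `L` large enough")] -/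
def cutoffL (m r : ℕ) : ℕ := ⌈max (lemmaL (lemma1Const m r) 2) (2 * r * m + 3)⌉₊

/-- `cutoffL ≥ lemmaL C 2`. [folklore] -/
theorem lemmaL_le_cutoffL (m r : ℕ) : lemmaL (lemma1Const m r) 2 ≤ (cutoffL m r : ℝ) :=
  (le_max_left _ _).trans (Nat.le_ceil _)

/-- `cutoffL ≥ 2rm + 3`. [folklore] -/
theorem le_cutoffL (m r : ℕ) : 2 * (r : ℝ) * m + 3 ≤ (cutoffL m r : ℝ) :=
  (le_max_right _ _).trans (Nat.le_ceil _)

/-- **The resonance cut-offs of §4 for the window**, packaged as `ResonanceCutoffs` with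
`Rθ = RS = 4r + 2r(n₂ - 1)` (`n₂ ≥ 1`). [cite: DeRoeckHuveneers2015, §4.2 Proposition 2 and its proof in §4.3] -/
def resonanceCutoffs (m r n₂ : ℕ) (hn₂ : 1 ≤ n₂) : ResonanceCutoffs m r (cutoffL m r) n₂ :=
  have hC := isLemma1Const_lemma1Const m r
  have hL := lemmaL_le_cutoffL m r
  have hL' := le_cutoffL m r
  have hL1 : (1 : ℝ) ≤ cutoffL m r := one_le_of_lemmaL hC hL
  have hL3 : (3 : ℝ) ≤ cutoffL m r := le_trans (le_add_of_nonneg_left (by positivity)) hL'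
  have hLr : 2 * (r : ℝ) * m ≤ cutoffL m r := by linarith
  { θ := fun x => thetaW r (cutoffL m r : ℝ) n₂ x
    Rθ := clusterRad r n₂
    RS := clusterRad r n₂
    multiRes := fun x δ => multiResW r (cutoffL m r : ℝ) n₂ x δ
    symbol := fun x => isDeltaSymbol_thetaW hL1
    nonneg := fun x δ w => thetaX_nonneg n₂ x δ (wvec w)
    le_one := fun x δ w => thetaX_le_one n₂ x δ (wvec w)
    dependsOn := fun x δ => dependsOn_thetaW δ
    nonres_of_pos := fun δ hδ _ x w h k hk hn => nonres_of_thetaX_pos hn₂ hL3 hδ h hk hn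
    fderiv_eq_zero := fun δ hδ hδ1 x w hw k hk hres => fderiv_thetaW_eq_zero hC hL hδ hδ1 hw hk hres
    nearRes_of_lt_one := fun δ hδ _ x w h => by
      have := nearRes_of_thetaX_lt_one (n₂ := n₂) (x := x) hL1 hLr hδ h
      simpa using this
    multiRes_subset := fun δ hδ _ x w hw => by
      have := multiResW_subset (n₂ := n₂) (x := x) hL1 hLr hδ hw
      simpa using this }

/-- **Existence of the §4 cut-offs with `m`-independent radii.** [cite: DeRoeckHuveneers2015, §4.2 Proposition 2] -/
theorem exists_cutoffs (m r n₂ : ℕ) (hn₂ : 1 ≤ n₂) :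
    ∃ L : ℕ, ∃ Θ : ResonanceCutoffs m r L n₂, Θ.Rθ = clusterRad r n₂ ∧ Θ.RS = clusterRad r n₂ :=
  ⟨cutoffL m r, resonanceCutoffs m r n₂ hn₂, rfl, rfl⟩

end Literature.Barriers.AtomisticToContinuum.HeatConduction.RotorChain

end
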